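import Literature.NumberTheory.Congruences.BernoulliCharacterTeichmullerCongruence
import HarnessLib

/-!
# Carlitz's integrality of `(1/k) B_{k,χ}` at an odd prime `ℓ` — ANY level, ANY `k ≥ 1`
# (the level may be divisible by `ℓ`; no bound `k ≤ ℓ − 2`)

Topic `Literature/NumberTheory/Congruences`; namespace `Literature.NumberTheory.Congruences.CarlitzIntegrality`.
THEOREMS ONLY (no definition, no named fact, no instance).

L. Carlitz [Carlitz1959] proved that for a primitive Dirichlet character `ψ ≠ 1` of conductor `f` the number
`d · (1/k) · B_{k,ψ}` is an algebraic integer, where `d = 1` when `f` has two distinct prime factors, `d = k·f`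
when `f` is an odd prime, … (the statement is printed, with these `d`, in [BillereyMenares2018, proof of Lemma 3]).
This file proves the `ℓ`-ADIC heart of that theorem, for an odd prime `ℓ`, by Lang's measure-theoretic route
(*Cyclotomic Fields I–II*, Ch. 2 §2, Thms 2.1 and 2.4), which the tree has already formalised for EVERY level — the
tree's `TeichmullerTwist.norm_regBernoulliDist_div_le_one` / `norm_bernoulliMeasure_zero_le_one` carry no hypothesis
`ℓ ∤ N`, and `EllipticCurves.bernoulliMeasure_zero_eq` is the identity
`(θE_{k,c})(ℤ_ℓ) = (1/k)(1 − θ(c)c^k) · ∑_{b mod N} θ(b) N^{k−1}B_k(b/N)`: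

* `norm_sum_mul_bernoulliDist_div_le_one_of_unit` — for an `N`-periodic `θ : ℕ → ℤ_ℓ` (any `N ≥ 1`), `k ≥ 1`, and an
  auxiliary `c` prime to `Nℓ` with `θ(cx) = θ(c)θ(x)` and `1 − θ(c)c^k` an `ℓ`-adic unit:
  `‖(1/k) ∑_{b mod N} θ(b) N^{k−1}B_k(b/N)‖_ℓ ≤ 1`;
* `norm_generalizedBernoulli_div_le_one_of_unit` — the same for a Dirichlet character `χ` modulo `N` with values in
  `ℚ_ℓ`: a unit `1 − χ(c)c^k` gives `‖(1/k)B_{k,χ}‖_ℓ ≤ 1`. This GENERALISES the tree's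
  `CharacterTwist.norm_generalizedBernoulli_div_le_one` (which needs `ℓ ∤ N` and `2 ≤ k ≤ ℓ − 2`, choosing `c` a primitive
  root mod `ℓ`, `≡ 1 (mod N)`);
* `norm_sum_mul_bernoulliDist_div_le_one_of_apply_eq_neg_one`, `norm_generalizedBernoulli_div_le_one_of_apply_eq_neg_one` — CARLITZ'S CASE «conductor not a power of `ℓ`» in the form
  consumers use: if some `c` prime to `Nℓ` with `c ≡ 1 (mod ℓ)` has `χ(c) = −1`, then `(1/k)B_{k,χ}` is `ℓ`-integral
  (`1 − χ(c)c^k ≡ 2 (mod ℓ)` is a unit). For a quadratic character `χ = χ₁χ₂` with coprime non-trivial factors such a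
  `c` exists for every odd `ℓ` (Chinese remainder), which is how the cut Cohen numbers of crux
  `PrintCFram.BottomClassIndexLawFiveLe` (cell `bsd-print-cfram`) become integral away from `2`;
* `norm_mul_sum_mul_bernoulliDist_le_one_of_dvd` / `norm_mul_generalizedBernoulli_le_one_of_dvd` — the complementary
  bound for the excluded case: if `ℓ ∣ N` (and `θ(1) = 1`) then `‖N · B_{k,θ}‖_ℓ ≤ 1` — the auxiliary `c = 1 + N` and
  lifting the exponent `v_ℓ((1+N)^k − 1) = v_ℓ(N) + v_ℓ(k)`; Carlitz's `d = k·f` for a prime conductor `f = ℓ`.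

## Honest column

* Only ODD `ℓ` (Lang's `E_{1,c}` has the term `(c−1)/2`; the tree's Thm 2.1 (i) is stated for `p ≠ 2`). Carlitz's full
  theorem also controls the prime `2` (`d = 1` for two distinct prime factors); not here — TODO(general form).
* The auxiliary-unit hypothesis is the user's to discharge; for `ℓ ∤ N`, `2 ≤ k ≤ ℓ−2` the tree's `exists_auxiliary` does it.

## References

* L. Carlitz, *Arithmetic properties of generalized Bernoulli numbers*, J. reine angew. Math. 202 (1959) 174–182. [Carlitz1959]
* N. Billerey, R. Menares, *Strong modularity of reducible Galois representations*, Trans. AMS 370 (2018), proof of Lemma 3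
  (arXiv:1604.01173 p. 5: the values of `d`). [BillereyMenares2018]
* S. Lang, *Cyclotomic Fields I and II*, GTM 121 (1990), Ch. 2 §2, Thms 2.1, 2.4 (PDF pp. 35–38). [LangCyclotomic1990]
-/

noncomputable section

open Finset Literature.NumberTheory.EllipticCurves Literature.NumberTheory.LFunctions
  Literature.NumberTheory.Congruences.CharacterTwist DirichletCharacter

namespace Literature.NumberTheory.Congruences.CarlitzIntegrality

variable {ℓ : ℕ} [hℓ : Fact ℓ.Prime]

/-! ### §1. The measure-theoretic bound at any level -/

section AnyLevel

variable {N : ℕ} [NeZero N] {c k : ℕ} {θ : ℕ → ℤ_[ℓ]}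

/-- Transport of a level written in two ways (`N · ℓ^0 = N`). [folklore] -/
private theorem sum_level_eq {L L' : ℕ} [NeZero L] [NeZero L'] (h : L = L')
    (F : (T : ℕ) → ZMod T → ℚ_[ℓ]) :
    ∑ b : ZMod L, F L b = ∑ b : ZMod L', F L' b := by
  subst h
  rfl

/-- **Lang Ch. 2 §2, Thms 2.1 + 2.4 at ANY level, as an integrality statement.** For an odd prime `ℓ`, `N ≥ 1`
(divisible by `ℓ` or not), an `N`-periodic `θ : ℕ → ℤ_ℓ`, `k ≥ 1`, and `c` prime to `Nℓ` with `θ(cx) = θ(c)θ(x)`: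
`‖(1 − θ(c)c^k) · (1/k) · ∑_{b mod N} θ(b) N^{k−1} B_k(b/N)‖_ℓ ≤ 1` — the total mass of the `ℤ_ℓ`-valued measure `θE_{k,c}`
(`bernoulliMeasure_zero_eq`, `TeichmullerTwist.norm_bernoulliMeasure_zero_le_one`).
[cite: LangCyclotomic1990, Ch. 2 §2, Thm. 2.1 (i) and Thm. 2.4 (PDF pp. 35–38)] -/
theorem norm_one_sub_mul_sum_mul_bernoulliDist_div_le_one (hℓ2 : ℓ ≠ 2) (hc : c.Coprime (N * ℓ))
    (hθ : ∀ b, θ (b + N) = θ b) (hθc : ∀ x, θ (c * x) = θ c * θ x) (hk : 1 ≤ k) :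
    ‖(1 - ((θ c : ℤ_[ℓ]) : ℚ_[ℓ]) * (c : ℚ_[ℓ]) ^ k) * ((k : ℚ_[ℓ])⁻¹ *
        ∑ b : ZMod N, ((θ b.val : ℤ_[ℓ]) : ℚ_[ℓ]) * ((bernoulliDist k N b : ℚ) : ℚ_[ℓ]))‖ ≤ 1 := by
  have hM := bernoulliMeasure_zero_eq ℓ (N := N) (θ := θ) hc hθ hθc k
  have hN0 : N * ℓ ^ 0 = N := by rw [pow_zero, mul_one]
  have h0 : ∑ b : ZMod (N * ℓ ^ 0), ((θ b.val : ℤ_[ℓ]) : ℚ_[ℓ]) *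
      ((bernoulliDist k (N * ℓ ^ 0) b : ℚ) : ℚ_[ℓ]) =
      ∑ b : ZMod N, ((θ b.val : ℤ_[ℓ]) : ℚ_[ℓ]) * ((bernoulliDist k N b : ℚ) : ℚ_[ℓ]) :=
    sum_level_eq hN0 (fun T b ↦ ((θ b.val : ℤ_[ℓ]) : ℚ_[ℓ]) * ((bernoulliDist k T b : ℚ) : ℚ_[ℓ]))
  have hint := TeichmullerTwist.norm_bernoulliMeasure_zero_le_one (N := N) (θ := θ) (k := k) hℓ2 hc hθ hk
  rw [hM, h0] at hint
  calc _ = ‖(k : ℚ_[ℓ])⁻¹ * (1 - ((θ c : ℤ_[ℓ]) : ℚ_[ℓ]) * (c : ℚ_[ℓ]) ^ k) *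
        ∑ b : ZMod N, ((θ b.val : ℤ_[ℓ]) : ℚ_[ℓ]) * ((bernoulliDist k N b : ℚ) : ℚ_[ℓ])‖ := by
        congr 1; ring
    _ ≤ 1 := hint

/-- **Carlitz's `ℓ`-adic integrality, measure form.** With the data of
`norm_one_sub_mul_sum_mul_bernoulliDist_div_le_one`, if moreover `1 − θ(c)c^k` is an `ℓ`-adic UNIT then
`‖(1/k) · ∑_{b mod N} θ(b) N^{k−1} B_k(b/N)‖_ℓ ≤ 1`. No hypothesis `ℓ ∤ N`, no bound on `k`.
[cite: LangCyclotomic1990, Ch. 2 §2, Thm. 2.4 and the proof of Thm. 2.5 (PDF p. 38)] -/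
theorem norm_sum_mul_bernoulliDist_div_le_one_of_unit (hℓ2 : ℓ ≠ 2) (hc : c.Coprime (N * ℓ))
    (hθ : ∀ b, θ (b + N) = θ b) (hθc : ∀ x, θ (c * x) = θ c * θ x) (hk : 1 ≤ k)
    (hu : ‖1 - ((θ c : ℤ_[ℓ]) : ℚ_[ℓ]) * (c : ℚ_[ℓ]) ^ k‖ = 1) :
    ‖(k : ℚ_[ℓ])⁻¹ * ∑ b : ZMod N, ((θ b.val : ℤ_[ℓ]) : ℚ_[ℓ]) * ((bernoulliDist k N b : ℚ) : ℚ_[ℓ])‖ ≤ 1 := by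
  have h := norm_one_sub_mul_sum_mul_bernoulliDist_div_le_one hℓ2 hc hθ hθc hk
  rwa [norm_mul, hu, one_mul] at h

end AnyLevel

/-! ### §2. Dirichlet characters with values in `ℚ_ℓ` -/

section Character

variable {N : ℕ} [NeZero N] {c k : ℕ}

/-- **`(1/k) B_{k,χ}` is `ℓ`-integral as soon as `1 − χ(c)c^k` is a unit for some `c` prime to `Nℓ`** (`χ` a Dirichlet
character modulo ANY `N ≥ 1` with values in `ℚ_ℓ`, `ℓ` odd, `k ≥ 1`): Lang's Thm. 2.4
`(1/k)(1 − χ(c)c^k)B_{k,χ} = ∫ χ dE_{k,c} ∈ ℤ_ℓ`. Generalises `CharacterTwist.norm_generalizedBernoulli_div_le_one`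
(`ℓ ∤ N`, `2 ≤ k ≤ ℓ − 2`). [cite: LangCyclotomic1990, Ch. 2 §2, Thm. 2.4 (PDF p. 38)] -/
theorem norm_generalizedBernoulli_div_le_one_of_unit (hℓ2 : ℓ ≠ 2) (χ : DirichletCharacter ℚ_[ℓ] N)
    (hc : c.Coprime (N * ℓ)) (hk : 1 ≤ k) (hu : ‖1 - χ c * (c : ℚ_[ℓ]) ^ k‖ = 1) :
    ‖(k : ℚ_[ℓ])⁻¹ * generalizedBernoulli k χ‖ ≤ 1 := by
  set θ : ℕ → ℤ_[ℓ] := fun b ↦ ⟨χ (b : ZMod N), norm_apply_le_one χ _⟩ with hθ_def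
  have hθ : ∀ b, θ (b + N) = θ b := fun b ↦ by
    apply PadicInt.ext
    simp only [hθ_def, Nat.cast_add, ZMod.natCast_self, add_zero]
  have hθc : ∀ x, θ (c * x) = θ c * θ x := fun x ↦ by
    apply PadicInt.ext
    simp only [hθ_def, Nat.cast_mul, map_mul, PadicInt.coe_mul]
  have hsum : ∑ b : ZMod N, ((θ b.val : ℤ_[ℓ]) : ℚ_[ℓ]) * ((bernoulliDist k N b : ℚ) : ℚ_[ℓ]) =
      generalizedBernoulli k χ := by
    rw [generalizedBernoulli_eq_sum_bernoulliDist hk]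
    refine Finset.sum_congr rfl fun b _ ↦ ?_
    simp only [hθ_def, ZMod.natCast_zmod_val]
  have hθc' : ((θ c : ℤ_[ℓ]) : ℚ_[ℓ]) = χ c := by simp only [hθ_def]
  have h := norm_sum_mul_bernoulliDist_div_le_one_of_unit hℓ2 hc hθ hθc hk (by rw [hθc']; exact hu)
  rwa [hsum] at h

omit [NeZero N] in
/-- `c ≡ 1 (mod ℓ)` makes `1 + c^k = 2 + (c^k − 1) ≡ 2 (mod ℓ)` an `ℓ`-adic unit for odd `ℓ`. [folklore] -/
private theorem norm_one_add_pow_eq_one (hℓ2 : ℓ ≠ 2) (hc1 : (c : ZMod ℓ) = 1) (k : ℕ) :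
    ‖(1 : ℚ_[ℓ]) + (c : ℚ_[ℓ]) ^ k‖ = 1 := by
  -- `1 + c^k = 2 + (c^k − 1)` with `ℓ ∣ c^k − 1`
  have hdvd : (ℓ : ℤ) ∣ (c : ℤ) ^ k - 1 := by
    have h1 : ((c : ℕ) : ZMod ℓ) ^ k = 1 := by rw [hc1, one_pow]
    refine (ZMod.intCast_zmod_eq_zero_iff_dvd ((c : ℤ) ^ k - 1) ℓ).mp ?_
    push_cast
    rw [h1, sub_self]
  have hsmall : ‖((c : ℚ_[ℓ]) ^ k - 1)‖ < 1 := by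
    have : ((c : ℚ_[ℓ]) ^ k - 1) = (((c : ℤ) ^ k - 1 : ℤ) : ℚ_[ℓ]) := by push_cast; ring
    rw [this]
    exact Padic.norm_intCast_lt_one_iff.mpr hdvd
  have htwo : ‖(2 : ℚ_[ℓ])‖ = 1 := by
    have h2 : ¬ (ℓ : ℤ) ∣ (2 : ℤ) := by
      intro h
      have := Int.le_of_dvd (by norm_num) h
      have h2' : (ℓ : ℤ) = 1 ∨ (ℓ : ℤ) = 2 := by
        have := hℓ.out.two_le; omega
      rcases h2' with h' | h'
      · exact hℓ.out.one_lt.ne' (by exact_mod_cast h')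
      · exact hℓ2 (by exact_mod_cast h')
    have := (Padic.norm_int_le_one (p := ℓ) 2)
    have hlt : ¬ ‖((2 : ℤ) : ℚ_[ℓ])‖ < 1 := fun h ↦ h2 (Padic.norm_intCast_lt_one_iff.mp h)
    push_cast at this hlt
    exact le_antisymm this (not_lt.mp hlt)
  have e : (1 : ℚ_[ℓ]) + (c : ℚ_[ℓ]) ^ k = 2 + ((c : ℚ_[ℓ]) ^ k - 1) := by ring
  rw [e]
  have hne : ‖(2 : ℚ_[ℓ])‖ ≠ ‖((c : ℚ_[ℓ]) ^ k - 1)‖ := by rw [htwo]; exact (ne_of_gt hsmall)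
  rw [IsUltrametricDist.norm_add_eq_max_of_norm_ne_norm hne, htwo, max_eq_left hsmall.le]

/-- **Carlitz's integrality, measure form with the value `−1`**: for an odd prime `ℓ`, an `N`-periodic `θ : ℕ → ℤ_ℓ`
(any `N ≥ 1`), `k ≥ 1`, and `c` prime to `Nℓ` with `θ(cx) = θ(c)θ(x)`, `c ≡ 1 (mod ℓ)` and `θ(c) = −1`:
`‖(1/k) ∑_{b mod N} θ(b) N^{k−1} B_k(b/N)‖_ℓ ≤ 1` (`1 − θ(c)c^k = 1 + c^k ≡ 2` is a unit). This is the shape in which an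
INTEGER-valued Kronecker symbol `χ_D` (cast into `ℤ_ℓ`) is fed, with no `ℚ_ℓ`-valued Dirichlet character needed.
[cite: BillereyMenares2018, proof of Lemma 3 (Carlitz's theorem, arXiv p. 5)] -/
theorem norm_sum_mul_bernoulliDist_div_le_one_of_apply_eq_neg_one {θ : ℕ → ℤ_[ℓ]} (hℓ2 : ℓ ≠ 2)
    (hc : c.Coprime (N * ℓ)) (hθ : ∀ b, θ (b + N) = θ b) (hθc : ∀ x, θ (c * x) = θ c * θ x) (hk : 1 ≤ k)
    (hc1 : (c : ZMod ℓ) = 1) (hθm : θ c = -1) :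
    ‖(k : ℚ_[ℓ])⁻¹ * ∑ b : ZMod N, ((θ b.val : ℤ_[ℓ]) : ℚ_[ℓ]) * ((bernoulliDist k N b : ℚ) : ℚ_[ℓ])‖ ≤ 1 :=
  norm_sum_mul_bernoulliDist_div_le_one_of_unit hℓ2 hc hθ hθc hk
    (by rw [hθm, PadicInt.coe_neg, PadicInt.coe_one, neg_one_mul, sub_neg_eq_add]
        exact norm_one_add_pow_eq_one hℓ2 hc1 k)

/-- **Carlitz: `(1/k) B_{k,χ}` is `ℓ`-integral when `χ` takes the value `−1` at some `c ≡ 1 (mod ℓ)` prime to `N`**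
(`ℓ` odd, `k ≥ 1`, any level `N`). For a primitive character this is the case «the conductor is not a power of `ℓ`»
of Carlitz's theorem (`d = 1`): e.g. `B_{3,χ_{−15}}/3 = 16`, whereas `B_{3,χ_{−7}}/3 = 16/7` (prime conductor `7`,
`(7−1) ∣ (7−1)/2 + 3`). [cite: BillereyMenares2018, proof of Lemma 3 (Carlitz's theorem, arXiv p. 5)] -/
theorem norm_generalizedBernoulli_div_le_one_of_apply_eq_neg_one (hℓ2 : ℓ ≠ 2)
    (χ : DirichletCharacter ℚ_[ℓ] N) (hc : c.Coprime (N * ℓ)) (hc1 : (c : ZMod ℓ) = 1) (hχc : χ c = -1)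
    (hk : 1 ≤ k) : ‖(k : ℚ_[ℓ])⁻¹ * generalizedBernoulli k χ‖ ≤ 1 :=
  norm_generalizedBernoulli_div_le_one_of_unit hℓ2 χ hc hk
    (by rw [hχc, neg_one_mul, sub_neg_eq_add]; exact norm_one_add_pow_eq_one hℓ2 hc1 k)

end Character

/-! ### §3. The bound when `ℓ` divides the level (prime-power conductors) -/

section LevelBound

variable {N : ℕ} [NeZero N] {k : ℕ} {θ : ℕ → ℤ_[ℓ]}

omit [NeZero N] in
/-- Iterated periodicity: `θ (b + jN) = θ b`. [folklore] -/
private theorem periodic_mul (hθ : ∀ b, θ (b + N) = θ b) (b j : ℕ) : θ (b + j * N) = θ b := by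
  induction j with
  | zero => rw [zero_mul, add_zero]
  | succ j ih => rw [Nat.succ_mul, ← add_assoc, hθ, ih]

/-- The norm of a non-zero natural number in `ℚ_ℓ` is `ℓ^{−v_ℓ(n)}`. [folklore] -/
private theorem norm_natCast_eq_zpow {n : ℕ} (hn : n ≠ 0) :
    ‖(n : ℚ_[ℓ])‖ = (ℓ : ℝ) ^ (-(padicValNat ℓ n : ℤ)) := by
  rw [Padic.norm_eq_zpow_neg_valuation (by exact_mod_cast hn), Padic.valuation_natCast]

/-- **If `ℓ ∣ N` then `N · ∑_{b mod N} θ(b) N^{k−1}B_k(b/N)` is `ℓ`-integral** (`ℓ` odd, `θ` `N`-periodic with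
`θ(1) = 1`, `k ≥ 1`) — the complement of Carlitz's unit case: take the auxiliary `c = 1 + N` (so `θ(cx) = θ(x)`,
`θ(c) = 1`); Lang's Thm 2.4 gives `(1 − c^k)(1/k)B_{k,θ} ∈ ℤ_ℓ`, and by lifting the exponent
`v_ℓ((1+N)^k − 1) = v_ℓ(N) + v_ℓ(k)`, so `‖N·B_{k,θ}‖_ℓ ≤ 1`. For a character of prime conductor `f = ℓ` this is
Carlitz's `d = k·f`: e.g. `7 · B_{3,χ_{−7}} = 48`. [cite: BillereyMenares2018, proof of Lemma 3 (Carlitz's theorem, arXiv p. 5)] -/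
theorem norm_mul_sum_mul_bernoulliDist_le_one_of_dvd (hℓ2 : ℓ ≠ 2) (hℓN : ℓ ∣ N)
    (hθ : ∀ b, θ (b + N) = θ b) (hθ1 : θ 1 = 1) (hk : 1 ≤ k) :
    ‖(N : ℚ_[ℓ]) * ∑ b : ZMod N, ((θ b.val : ℤ_[ℓ]) : ℚ_[ℓ]) * ((bernoulliDist k N b : ℚ) : ℚ_[ℓ])‖ ≤ 1 := by
  have hN0 : N ≠ 0 := NeZero.ne N
  have hk0 : k ≠ 0 := by omega
  have hℓp := hℓ.out
  -- the auxiliary `c = 1 + N`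
  set c : ℕ := 1 + N with hc_def
  have hcN : c.Coprime N := by
    rw [hc_def, Nat.coprime_comm, Nat.coprime_add_self_right]; exact Nat.coprime_one_right N
  have hcℓ : c.Coprime ℓ := by
    rw [hc_def, Nat.coprime_comm, Nat.Prime.coprime_iff_not_dvd hℓp]
    intro h
    exact hℓp.not_dvd_one ((Nat.dvd_add_left hℓN).mp h)
  have hc : c.Coprime (N * ℓ) := Nat.Coprime.mul_right hcN hcℓ
  have hθc1 : θ c = 1 := by rw [hc_def, ← one_mul N, periodic_mul hθ 1 1, hθ1]
  have hθc : ∀ x, θ (c * x) = θ c * θ x := fun x ↦ by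
    rw [hθc1, one_mul, hc_def, add_mul, one_mul, mul_comm N x, periodic_mul hθ x x]
  have h := norm_one_sub_mul_sum_mul_bernoulliDist_div_le_one hℓ2 hc hθ hθc hk
  rw [hθc1, PadicInt.coe_one, one_mul] at h
  -- `‖1 − c^k‖_ℓ = ‖N‖_ℓ · ‖k‖_ℓ` by lifting the exponent
  have hlt : 1 < c := by rw [hc_def]; have := Nat.pos_of_ne_zero hN0; omega
  have hpow : 1 ≤ c ^ k := Nat.one_le_pow _ _ (by omega)
  have hval : padicValNat ℓ (c ^ k - 1) = padicValNat ℓ N + padicValNat ℓ k := by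
    have hodd : Odd ℓ := hℓp.odd_of_ne_two hℓ2
    have h1 : padicValNat ℓ (c ^ k - 1 ^ k) = padicValNat ℓ (c - 1) + padicValNat ℓ k :=
      padicValNat.pow_sub_pow hodd hlt (by rw [hc_def, Nat.add_sub_cancel_left]; exact hℓN)
        (fun h ↦ (Nat.Prime.coprime_iff_not_dvd hℓp).mp hcℓ.symm h) hk0
    rwa [one_pow, hc_def, Nat.add_sub_cancel_left] at h1
  have hsub : (1 : ℚ_[ℓ]) - (c : ℚ_[ℓ]) ^ k = -(((c ^ k - 1 : ℕ)) : ℚ_[ℓ]) := by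
    rw [Nat.cast_sub hpow]; push_cast; ring
  have hne : c ^ k - 1 ≠ 0 := by
    have : 1 < c ^ k := Nat.one_lt_pow hk0 hlt
    omega
  have hnorm : ‖(1 : ℚ_[ℓ]) - (c : ℚ_[ℓ]) ^ k‖ = ‖(N : ℚ_[ℓ])‖ * ‖(k : ℚ_[ℓ])‖ := by
    rw [hsub, norm_neg, norm_natCast_eq_zpow hne, norm_natCast_eq_zpow hN0, norm_natCast_eq_zpow hk0, hval,
      ← zpow_add₀ (by exact_mod_cast hℓp.ne_zero)]
    congr 1; push_cast; ring
  -- conclude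
  have hk' : (k : ℚ_[ℓ]) ≠ 0 := by exact_mod_cast hk0
  have hknorm : ‖(k : ℚ_[ℓ])‖ ≠ 0 := norm_ne_zero_iff.mpr hk'
  rw [norm_mul, hnorm, norm_mul, norm_inv] at h
  rw [norm_mul]
  calc ‖(N : ℚ_[ℓ])‖ * _ = ‖(N : ℚ_[ℓ])‖ * ‖(k : ℚ_[ℓ])‖ * (‖(k : ℚ_[ℓ])‖⁻¹ * _) := by
        field_simp
    _ ≤ 1 := h

/-- **`‖N · B_{k,χ}‖_ℓ ≤ 1` when `ℓ ∣ N`** for a Dirichlet character `χ` modulo `N` with values in `ℚ_ℓ` (`ℓ` odd,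
`k ≥ 1`): for a primitive character of prime conductor `N = ℓ` this is the prime-conductor case of Carlitz's theorem
(`k·ℓ · (1/k)B_{k,χ}` integral), sharp exactly when `(ℓ − 1) ∣ (ℓ−1)/2 + k` for the quadratic `χ`
(`7·B_{3,χ_{−7}} = 48`, `11 · B_{5,χ_{−11}} = −12750`). [cite: BillereyMenares2018, proof of Lemma 3 (Carlitz's theorem, arXiv p. 5)] -/
theorem norm_mul_generalizedBernoulli_le_one_of_dvd (hℓ2 : ℓ ≠ 2) (hℓN : ℓ ∣ N)
    (χ : DirichletCharacter ℚ_[ℓ] N) (hk : 1 ≤ k) : ‖(N : ℚ_[ℓ]) * generalizedBernoulli k χ‖ ≤ 1 := by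
  set θ : ℕ → ℤ_[ℓ] := fun b ↦ ⟨χ (b : ZMod N), norm_apply_le_one χ _⟩ with hθ_def
  have hθ : ∀ b, θ (b + N) = θ b := fun b ↦ by
    apply PadicInt.ext
    simp only [hθ_def, Nat.cast_add, ZMod.natCast_self, add_zero]
  have hθ1 : θ 1 = 1 := by
    apply PadicInt.ext
    simp only [hθ_def, Nat.cast_one, map_one, PadicInt.coe_one]
  have hsum : ∑ b : ZMod N, ((θ b.val : ℤ_[ℓ]) : ℚ_[ℓ]) * ((bernoulliDist k N b : ℚ) : ℚ_[ℓ]) =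
      generalizedBernoulli k χ := by
    rw [generalizedBernoulli_eq_sum_bernoulliDist hk]
    refine Finset.sum_congr rfl fun b _ ↦ ?_
    simp only [hθ_def, ZMod.natCast_zmod_val]
  have h := norm_mul_sum_mul_bernoulliDist_le_one_of_dvd hℓ2 hℓN hθ hθ1 hk
  rwa [hsum] at h

end LevelBound

end Literature.NumberTheory.Congruences.CarlitzIntegrality

end
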